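import Mathlib
import HarnessLib
import HarnessLib.Audit
import Summits.BirchSwinnertonDyer.Statement
import Summits.BirchSwinnertonDyer.Rank1Residual.ManinConstantOne
import Literature.NumberTheory.EllipticCurves.ManinConstantSemistablePrimewise
import HarnessLib.Audit.Status.Attr

/-!
Route: ManinLocalTwoThree

# Route ManinLocalTwoThree — Manin's conjecture split by prime — the two residual local statements
at 2 and 3

It suffices to show X = X₂ ∧ X₃ ∧ X₅: for every globally minimal `W/ℚ`, every level `N` and every
`X₀(N)`-parametrisation datum `D` of `W` satisfying the lattice clause `Λ_W = c·Λ_f` (= `φ_D` is the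
optimal parametrisation, the tree's rendering of "strong Weil curve"), the Manin constant `c =
D.maninConstant` is prime to every ADDITIVE prime: X₂ (`ManinOddAtFour`, attacked): `4 ∣ N ⇒ 2 ∤ c`;
X₃ (`ManinPrimeToThreeAtNine`, attacked): `9 ∣ N ⇒ 3 ∤ c`; X₅ (`ManinPrimeToAdditiveFiveLe`,
RESIDUAL conjunct, imported not attacked): `p ≥ 5, p² ∣ N ⇒ p ∤ c`. With the printed
semistable-prime theorem (Mazur 1978 Cor. 4.1 ∧ Abbes–Ullmo 1996 Thm. A ∧ Česnavičius 2018 Thm. 1.2: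
`p² ∤ N ⇒ p ∤ c`, support `PrintedSemistableManinFacts` by name) no prime divides `c`, so `|c| = 1`
= Manin's conjecture, the route's RUNG item `ManinConstantOneRung` (rank 0), which is VERBATIM the
tree's conjecture leaf `Summit.BirchSwinnertonDyer.Rank1Residual.ManinConstant.ManinConstantOne`
(Manin 1971; `Iff.rfl`, Sketch.lean `maninConstantOneRung_iff`) — D-0061 rung shape: the registered
alternative closer «F2-MANIN» (gate `alt_closers`, class rung, loaded by director-bsd 2026-08-27) —
the deciding theorem `closes` concludes that leaf BY NAME through the Assembly item (never summit
credit). This is the ONE ledger line of cell bsd-f2-manin (D-0131 (3): «which local invariant at 2 /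
3 controls ord_p(c_E) for additive reduction»); the cell's typed laws (cards
ramified-twist-period-lattice-v3, manin-eta-two-hecke-pairing, kato-duality-manin-bound,
manin-infinity-cusp-witness, congruence-excess-type-law) become registered skeleton lines under X₂ /
X₃.
Lean: `∀ (W : WeierstrassCurve ℚ) [W.IsElliptic] [W.IsGloballyMinimal] {N : ℕ} [NeZero N] (D :
Literature.NumberTheory.EllipticCurves.ModularForms.ModularParametrizationData W N), (∀ z ∈
D.L.lattice, ∃ w ∈ Literature.NumberTheory.EllipticCurves.ModularForms.periodLattice D.f, z = D.c *
w) → ∀ p : ℕ, p.Prime → p ^ 2 ∣ N → ¬ (p : ℤ) ∣ D.maninConstant`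

## Assembly
Pure logic over the integers: fix an optimal datum D; for a prime p, if p² ∤ N then p ∤ c by the
tree theorem `cesnavicius2018_not_dvd_maninConstant_of_not_sq_dvd_level` fed with
`PrintedSemistableManinFacts`; if p² ∣ N then p = 2 (ManinOddAtFour), p = 3
(ManinPrimeToThreeAtNine) or p ≥ 5 (`Nat.Prime.five_le_of_ne_two_of_ne_three`,
ManinPrimeToAdditiveFiveLe); so no prime divides |c|, hence |c| = 1 (`Nat.exists_prime_and_dvd`,
`Int.abs_eq_natAbs`) — this composition `assembly_holds : Assembly` is kernel-checked in
folder/Sketch.lean (farm rc 0, 0 sorries; 20 lines) and is the route's PROVABLE-NOW item. The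
deciding theorem is `closes (hPF : PrintedSemistableManinFacts) (h2 : ManinOddAtFour) (h3 :
ManinPrimeToThreeAtNine) (h5 : ManinPrimeToAdditiveFiveLe) (hA : Assembly) : ManinConstantOneRung :=
hA hPF h2 h3 h5` (glue.lean; every binder consumed; D-0061 rung shape).

CLOSES_TARGET: closes rung F2-MANIN of BirchSwinnertonDyer: Summit.BirchSwinnertonDyer.Rank1Residual.ManinConstant.ManinConstantOne (D-0061; not the summit Statement) — the deciding theorem of this route concludes that registered leaf instead of the Statement decl `BirchSwinnertonDyer` (class rung: servable and labelled, never counted as concluding the summit Statement).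

Rationale: WHY THIS LINE. Manin's conjecture `c = ±1` is known prime by prime exactly at the primes `p` with
`p² ∤ N` (Mazur1978 Cor. 4.1, AbbesUllmo1996 Thm. A, Cesnavicius2018 = arXiv:1703.02951 Thm. 1.2;
tree theorem `cesnavicius2018_not_dvd_maninConstant_of_not_sq_dvd_level`), for `N ≤ 500000`
(Cremona, tree fact `cremona_abs_maninConstant_eq_one_of_level_le_500000`) and for `p ≥ 11` outside
potentially ordinary Kodaira types II/III/IV (EdixhovenManin1991 Thm. 3); at an additive prime print
has only valuation BOUNDS — `v_p(c) ≤ v_p(deg φ) + ε_p(N)` (CesnaviciusNeururerSaha2023 =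
arXiv:1911.09446 Thm. 1.2, "the additive reduction primes are the crux of the matter", p. 4) and
`v_p(c) ≤ μ_{S,p}` (Pasten, arXiv:1705.09251 Thm. 10.1, "in general it is not clear how to control
the Manin constant beyond the semi-stable case", p. 4). Splitting the conjecture by prime isolates
the two primes where additive reduction is generic and wild (`v₂(N) ≤ 8`, `v₃(N) ≤ 5`) as
stand-alone typed statements that downstream BSD₂/BSD₃ theorems already consume as hypotheses
(Kriz–Li arXiv:1606.03172 p. 4: "if E has additive reduction at 2, further assume its Manin constant
is odd"; arXiv:2203.12159 p. 6: "the Manin constant assumption is needed only when E has additive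
reduction at p"). The mechanism the cell brings is NÉRON-LATTICE TWIST TRANSPORT — every additive
class at 2 or 3 is compared with its quadratic (χ₋₄, χ±8, χ₋₃) twist orbit, where one member is
semistable or of smaller conductor exponent, through exact period-lattice identities (Stevens 1989
(5.2), Pal 2012, cell theorems `not_dvd_maninConstant_of_isTwistOfSemistableAtTwo_gamma0`,
`not_dvd_maninConstant_of_isTwistOfSemistableAt`, `optimal_commuting_scaling`) — plus
CONGRUENCE-MODULE control (Γ₁/Γ₀ comparison ČNS Lemma 6.5, Shimura-subgroup / Eisenstein
congruences, cell theorems W, S_p, T₃) for the twist-minimal classes; imported areas: modular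
symbols and Eichler–Shimura periods (analytic number theory), Néron models and finite flat group
schemes (arithmetic geometry), Hecke-algebra congruence modules (the Iwasawa-main-conjecture toolkit
of this seat's lens). No prior route of the summit states a Manin-constant crux at 2 or 3
(AdditiveKolyvaginRoad carries `p ∤ c` only at `p ≥ 5`; SchneiderFreeAdditiveX3 carries `v_p(c)` as
slack); the negatives index (1 entry, stmt-15532, a Kolyvagin pinch) is untouched.

RANKED CRUXES. #0 ManinConstantOneRung (target) — MANIN'S CONJECTURE (the rung): for every globally
minimal W/ℚ, every level N and every X₀(N)-parametrisation datum D of W with the lattice clause Λ_W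
= c·Λ_f (optimal parametrisation), |c| = 1 — verbatim the conjecture leaf
`Summit.BirchSwinnertonDyer.Rank1Residual.ManinConstant.ManinConstantOne` (spelled out, not aliased,
so the route reaches no @[conjecture] decl). (why it might fail: it is Manin's 1971 conjecture, open
beyond N ≤ 500000 and beyond the semistable primes; one optimal curve with |c| > 1 refutes it.)
[CesnaviciusNeururerSaha2023, AgasheRibetStein2006, Cesnavicius2018]
#2 ManinOddAtFour (crux) — for every globally minimal W/ℚ, every level N with 4 ∣ N and every
X₀(N)-datum D of W with Λ_W = c·Λ_f (optimal parametrisation), the Manin constant c is odd (Manin's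
conjecture at the prime 2 for curves additive at 2; the hypothesis of Kriz–Li 2019 and of every BSD₂
consumer). [deps: PrintedSemistableManinFacts] [difficulty: open-problem] (why it might fail: a
class with 4 ∣ N whose Γ₁-constant is 1 but c₀ = 2 (ČNS Lemma 6.5 allows c₀/c₁ ∈ {1,2}; Stevens' η =
2 exists at 11a) refutes it; twist transport needs η(W′) = 1 and twist-minimal classes (v₂(N) ∈
{5,…,8}) have no semistable partner.) [Cesnavicius2018, CesnaviciusNeururerSaha2023,
arXiv:1606.03172, AgasheRibetStein2006, Stevens1989]
#3 ManinPrimeToThreeAtNine (crux) — for every globally minimal W/ℚ, every level N with 9 ∣ N and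
every optimal X₀(N)-datum D of W (lattice clause), 3 ∤ c (Manin's conjecture at the prime 3 for
curves additive at 3). [deps: PrintedSemistableManinFacts] [difficulty: open-problem] (why it might
fail: twist-minimal classes at 3 (27 ∣ N, or 9 ∥ N not a χ₋₃-twist of a 3-semistable class) have no
transport partner; ČNS give only v₃(c) ≤ v₃(deg φ)(+1) and 3 ∣ deg φ is forced on whole families
(cell THEOREM T₃); Raynaud's e < p − 1 fails at p = 3.) [CesnaviciusNeururerSaha2023,
EdixhovenManin1991, arXiv:1705.09251, Stevens1989]
#4 ManinPrimeToAdditiveFiveLe (crux) — RESIDUAL conjunct (declared residual, not attacked by this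
cell): for every globally minimal W/ℚ, every N and every optimal X₀(N)-datum D of W, every prime p ≥
5 with p² ∣ N satisfies p ∤ c (open at p = 5, 7 and at p ≥ 11 of potentially ordinary Kodaira type
II/III/IV; the rest is Edixhoven 1991 Thm. 3). [difficulty: open-problem] (why it might fail: at p =
5, 7 Raynaud's constraint e < p − 1 on finite flat group schemes fails for e = 6 (Edixhoven's method
is void), and Pasten's Thm. 10.1 bounds v_p(c) without reaching 0; a single optimal curve with 25 ∣
N, 5 ∣ c beyond N = 500000 kills it.) [EdixhovenManin1991, arXiv:1705.09251,
CesnaviciusNeururerSaha2023]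
#9 PrintedSemistableManinFacts (support) — the three printed prime-by-prime sources in the tree's
lattice rendering, by name: Mazur 1978 Cor. 4.1 (odd p, p² ∤ N ⇒ p ∤ c), Abbes–Ullmo 1996 Thm. A (p
∤ N ⇒ p ∤ c), Česnavičius 2018 Thm. 1.2 (2 ∥ N ⇒ 2 ∤ c); Literature facts consumed as hypotheses
(precedent: AdditiveKolyvaginRoad.MazurManinConstantOddPrimes). SPLIT (EDIT 4, gen 1, rev 3): PF ⇐
the four BY-NAME shared items MazurManinConstantOddPrimes (stmt-19383) →
AbbesUllmoManinConstantGoodPrimes (stmt-20090) → CesnaviciusManinConstantAtTwo (stmt-20091) →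
NewformOfEllipticCurve (stmt-19382) via the glue item PrintedSemistableManinFactsOfParts
(stmt-BirchSwinnertonDyer-23061, `fun hM hAU hC hnf => ⟨hM, hAU, hC, hnf⟩`) — the facts are
hypotheses, never proof targets; the split is what makes the route staffable (0 unproved deps).
[difficulty: open-problem] [Mazur1978, AbbesUllmo1996, Cesnavicius2018]

TWO-LAYER PLAN. Foreseen glued splits (not filed now; each becomes a registered skeleton LINE under
its crux first): ManinOddAtFour ⇐ TwistCoveredAtTwo (every class with 4 ∣ N that is a
χ₋₄/χ₈/χ₋₈-twist of a 2-semistable class, ALL η — the η = 1 half is the tree theorem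
`not_dvd_maninConstant_of_isTwistOfSemistableAtTwo_gamma0`, the η = 2 half is card
manin-eta-two-hecke-pairing) → TwistMinimalAtTwo (classes with v₂(N) ≥ 5 or no semistable twist
partner: congruence-module route, cell theorems W / S₂ / DyadicTwistCongruence) → ManinOddAtFour.
ManinPrimeToThreeAtNine ⇐ TwistCoveredAtThree (χ₋₃-twists of 3-semistable classes incl. the
3-torsion case excluded by `htors` in `not_dvd_maninConstant_of_isTwistOfSemistableAt`) →
TwistMinimalAtThree (27 ∣ N and the 9 ∥ N twist-minimal classes: THEOREM T₃ + S₃ congruence control,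
es Kato-duality certificate) → ManinPrimeToThreeAtNine.

KILL CRITERIA. A refutation of ManinOddAtFour or of ManinPrimeToThreeAtNine (one optimal curve with
4 ∣ N and even c, resp. 9 ∣ N and 3 ∣ c) closes the route `refuted:<Decl>` AND refutes Manin's
conjecture itself — it is the cell's answer either way. A refutation of the residual
ManinPrimeToAdditiveFiveLe (or of the rung ManinConstantOneRung directly) kills Manin's conjecture
but not the cell's statements: pivot = re-open X₂ ∧ X₃ as a FRONTIER rung of their own. A proof of
ManinConstantOne by any other road (e.g. a full ČNS «reduce-to-compute» discharge) moots the route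
(`superseded`). TYPED KILL PATH BY NAME (landed p577034,
`Summits/BirchSwinnertonDyer/Rank1Residual/ManinAdditive/TwistOrbitDirectionLawRouteEdges.lean`):
`commutingOrbitDiscrDirectionR_three_of_C3 (hPF) (h3)` and `commutingOrbitDiscrDirectionR_of_C5
(hPF) (h5) (h5p)` give PrintedSemistableManinFacts → C3 (resp. C5) → `CommutingOrbitDiscrDirectionR
p` (p = 3, resp. every prime p ≥ 5): ONE commuting optimal p*-pair (W, W′ globally minimal, same
conductor N with p² ∣ N, W′ ≅ W ⊗ χ_{p*}, both X₀(N)-optimal data with the lattice clause) with deg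
φ′ = p·deg φ and v_p(Δ′_min) = v_p(Δ_min) − 6 (the only alternative to «+ 6» by the landed
near-invariance `CommutingOrbitManinValNear`, E-an-32) refutes `CommutingOrbitDiscrDirectionR p`,
hence — granted the printed facts — refutes C3 (p = 3) or the residual C5 (p ≥ 5). Census status: 0
exceptions / 667 706 optimal curves (an ordsplit-g5 6e8f75711cd3efd3, ref1 §R31 (iii)) and 0 in the
commuting-pair tables (D-an-4/6 tranche 1, IOTA-N500-rows-v1.tsv.gz 3ba56f1fb5bd8af1). A data-side
kill lands only as a NEGATIVE LEMMA MODULO inhabitation (a constructed `ModularParametrizationData`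
term with its lattice clause for both curves — modularity as data, absent from the tree) and modulo
the four printed facts (`--negative-modulo`, never `refuted-…`), exactly as for F-desc-ARS (ref1
§R31 (iii), §R32).

NOT DECOMPOSED YET. The twist-covered / twist-minimal partition of each crux (Two-layer plan) is
deliberately not filed: the partition predicate («W is a quadratic twist of a p-semistable class»,
Kraus/Connell conductor-exponent tables at 2 and 3) must first be typed once by the cell typer so
that both children share it; the η = 2 sub-case at 2 and the 3-torsion sub-case at 3 are layer-2
children of the covered halves. No constants to tune.

CHEAPEST FALSIFIER. One optimal elliptic curve with 4 ∣ N and 2 ∣ c, or 9 ∣ N and 3 ∣ c. Cremona's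
tables give c = 1 for every optimal curve of conductor ≤ 500000 (tree fact
`cremona_abs_maninConstant_eq_one_of_level_le_500000`, CesnaviciusNeururerSaha2023 §1), so the
falsifier lives at N > 500000; the cheapest NEW check a refuter can run this week is the ČNS
inequality's slack on the cell's census (HOME data table v1: optimal classes with 4 ∣ N or 9 ∣ N, N
≤ 500000, columns v_p(deg φ), v_p(r_E/m_E)): any class with v_p(c) forced ≥ 1 by a future identity
would have to show v_p(deg φ) ≥ 1 there — the table bounds where a counterexample could hide, it
cannot produce one.

NUMBERS. v₂(N) ≤ 8, v₃(N) ≤ 5, v_p(N) ≤ 2 for p ≥ 5 (conductor exponents over ℚ; arXiv:1705.09251 p.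
33). Known range: |c| = 1 for all optimal curves with N ≤ 500000 (Cremona;
CesnaviciusNeururerSaha2023 §1). ČNS Thm. 1.2: v_p(c) ≤ v_p(deg φ) + 1 if (p = 2, v₂(N) ≥ 3, no p′ ∣
N with p′ ≡ 3 mod 4) or (p = 3, v₃(N) ≥ 3, no p′ ∣ N with p′ ≡ 2 mod 3), else v_p(c) ≤ v_p(deg φ)
(arXiv:1911.09446 p. 3). ČNS Lemma 6.5: c_{Γ₀}/c_{Γ₁} ∈ {1, 2} (tree
`cesnaviciusNeururerSaha_lemma_6_5_dvd`). Edixhoven 1991 Thm. 3: p ∤ c for p ≥ 11 outside additive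
potentially ordinary reduction of Kodaira type II, III, IV.

DEFINITION REQUESTS. None: every constant is in the tree (`ModularParametrizationData`,
`maninConstant`, `periodLattice`, the three printed facts, the leaf `ManinConstantOne`). Wanted
texts already queued by the cell: acq-13220 (Ling–Oesterlé 1991), acq-09831 (Stein–Watkins 2002).

Novelty: Searches (2026-08-27): `lit search '"Manin constant" additive' --source local` (12 docs:
arXiv:1911.09446 pp 2–4, arXiv:1705.09251 pp 4/13/33, arXiv:1606.03172 pp 4/16,
doi:10.1017/fms.2019.9 p 14, arXiv:2203.12159 pp 6/17, doi:10.4171/dm/450 p 5, arXiv:2004.05492,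
arXiv:1808.07726, arXiv:math/0408126, arXiv:1608.06423, pamq-2006-v2-n2-a8); `lit search --hybrid
"Manin constant additive reduction optimal curve"` (10 docs, all off-topic); `lit vsearch "Manin
constant … additive reduction at 2 or 3 …" --papers` (6 docs: Conrad–Edixhoven–Stein 2003 «J₁(p) has
connected fibers» pp 57–58, 65; Dokchitser² 2010); `lit galaxy search "Manin constant" --star all`
(18 rows: panama Cohen GTM 239/240, Bosma–Cannon (Cremona's chapter), Cornell–Silverman–Stevens,
Delbourgo, Lang; pdf ANT 10:2 (2016), Kohen–Pacetti, Pal 2012 [galaxy:pdf:-8807213389083408320]);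
`lit galaxy search "Manin constant is odd|odd Manin constant|Manin constant is a 2-adic unit" --star
pdf` (0 hits); `ledger negatives --problem BirchSwinnertonDyer` (1 entry, unrelated); `ledger idea
list` (8 cell cards, listed in front-matter); `lean search` for `maninConstant` cruxes in Theses/*
(AdditiveKolyvaginRoad: p ≥ 5 only; SchneiderFreeAdditiveX3: v_p(c) slack only).
Nearest prior art found: Cesnavicius2018 Thm. 1.2 [corpus:paper:arxiv-1703.02951 p3] (p² ∤ N ⇒ p ∤ c
— the complement of our cruxes); CesnaviciusNeururerSaha2023 Thm. 1.2 [corpus:paper:arxiv-1911.09446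
p0003 L40–66, p0004 L8] (v_p(c) ≤ v_p(deg φ) + ε; «additive re  [refs: 10.1017/fms.2019.9, 10.4171/dm/450, 1911.09446, 1705.09251, 1606.03172, 2203.12159, 2004.05492, 1808.07726, math/0408126, 1608.06423, doi:10.1017/fms.2019.9, doi:10.4171/dm/450, paper:arxiv-1703.02951, paper:arxiv-1911.09446, paper:arxiv-1705.09251, paper:arxiv-1606.03172, Cesnavicius2018, CesnaviciusNeururerSaha2023, EdixhovenManin1991, Stevens1989]

Barriers (technique_class: twist-transport, neron-lattice, qexp-integrality, congruence): - technique_class: twist-transport, neron-lattice, qexp-integrality, congruence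
- Literature.Barriers.BirchSwinnertonDyer.AnomalousHeegnerLogWall: does not apply — outside its
technique class: the wall quantifies over refereed Heegner-log / BDP-value congruences at a GOOD
Eisenstein prime p (`PrintedEisensteinHeegnerLogScope W p` needs `Good W p`); every crux here is at
a prime of ADDITIVE reduction (p² ∣ N) and concerns the period comparison φ*ω_E = c·ω_f, not log_ω
P_K or a BDP value; the «congruence» token of this route means Hecke congruence modules at additive
level (Γ₁/Γ₀ comparison, Shimura-subgroup / Eisenstein congruences bounding [Λ₁:Λ₀]), never a
Heegner-log congruence. A skeleton line that imported a Kriz–Li-type unit statement at an anomalous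
pair would hit the wall and must say so.
- Literature.Barriers.BirchSwinnertonDyer.EisensteinMuBarrier: does not apply — outside its
technique class: the barrier blocks μ = 0 roads to Mazur's main conjecture at an odd GOOD-ORDINARY
or MULTIPLICATIVE Eisenstein prime (`GoodOrd W p ∨ Mult W p`); the cruxes sit at additive p ∈ {2, 3}
(and the residual at additive p ≥ 5) and invoke no main conjecture, no μ-invariant and no
characteristic ideal; this seat's IMC lens is used only for its integrality toolkit (Λ-adic
q-expansion integrality, congruence modules), not for char X = (L_p).
- Literature.Barriers.BirchSwinnertonDyer.AdditiveIwasawaTheoryAtTwoBarrier: does not apply to the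
cruxes as typed (no p-adic L-function or main conj

History (route lifecycle, newest last):
- 2026-08-27T21:24:43Z · rev 1: restated ManinOddAtFour (stmt-BirchSwinnertonDyer-22446), ManinPrimeToThreeAtNine (stmt-BirchSwinnertonDyer-22447), ManinPrimeToAdditiveFiveLe (stmt-BirchSwinnertonDyer-22448), Assembly (stmt-BirchSwinnertonDyer-22450) — EDIT 1 = birth repair (planner-of-record bsd-f2-manin-imc g7, before any serving: READY was  (planner-bsd-f2-manin-imc-g7-0)
- 2026-08-27T21:37:12Z · rev 1: restated ManinOddAtFour (stmt-BirchSwinnertonDyer-22446), ManinPrimeToThreeAtNine (stmt-BirchSwinnertonDyer-22447), ManinPrimeToAdditiveFiveLe (stmt-BirchSwinnertonDyer-22448), PrintedSemistableManinFacts (stmt-BirchSwinnertonDyer-22449) — EDIT 2 = birth repair, supersedes EDIT 1 (ticket tk-092813c1319b: NOT app (planner-bsd-f2-manin-imc-g7-0)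
- 2026-08-27T21:38:22Z · rev 1: restated ManinOddAtFour (stmt-BirchSwinnertonDyer-22446), ManinPrimeToThreeAtNine (stmt-BirchSwinnertonDyer-22447), ManinPrimeToAdditiveFiveLe (stmt-BirchSwinnertonDyer-22448), PrintedSemistableManinFacts (stmt-BirchSwinnertonDyer-22449) — EDIT 2 = birth repair, supersedes EDIT 1 (ticket tk-092813c1319b: NOT app (planner-bsd-f2-manin-imc-g7-0)
- 2026-08-27T21:47:54Z · rev 1: informal re-worded for ManinPrimeToAdditiveFiveLe (planner-bsd-f2-manin-imc-g7-0)
- 2026-08-27T22:15:48Z · rev 4: informal re-worded for PrintedSemistableManinFactsOfParts (planner-bsd-f2-manin-imc-g8-0)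

sub-problem: BirchSwinnertonDyer · status: open · opened planner-bsd-f2-manin-imc-g7-0 2026-08-27T20:50:32Z · rev 6 · ledger route-BirchSwinnertonDyer-ManinLocalTwoThree
GENERATED by the gate from the ledger (D-0016/17). Provers cite these decls: `theorem foo : Summit.BirchSwinnertonDyer.BirchSwinnertonDyer.Theses.ManinLocalTwoThree.<Decl> := …` in Summits/BirchSwinnertonDyer/BirchSwinnertonDyer/Theorems/<Name>.lean.
-/

namespace Summit.BirchSwinnertonDyer.BirchSwinnertonDyer.Theses.ManinLocalTwoThree

open scoped BigOperators Topology Manifold Classical MeasureTheory ProbabilityTheory Matrix InnerProductSpace ComplexConjugate ContinuousMap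
open Filter Set Function TopologicalSpace MeasureTheory

attribute [summit_statement] _root_.BirchSwinnertonDyer
attribute [summit_statement] _root_.Summit.BirchSwinnertonDyer.Rank1Residual.ManinConstant.ManinConstantOne

open Literature

/-- item stmt-BirchSwinnertonDyer-22445 · target · rank 0 · open · by planner
why it might fail: it is Manin's 1971 conjecture, open beyond N ≤ 500000 and beyond the semistable primes; one optimal curve with |c| > 1 refutes it.
sources: CesnaviciusNeururerSaha2023, AgasheRibetStein2006, Cesnavicius2018
[target] MANIN'S CONJECTURE (the rung): for every globally minimal W/ℚ, every level N and every
X₀(N)-parametrisation datum D of W with the lattice clause Λ_W = c·Λ_f (optimal parametrisation),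
|c| = 1 — verbatim the conjecture leaf
`Summit.BirchSwinnertonDyer.Rank1Residual.ManinConstant.ManinConstantOne` (spelled out, not aliased,
so the route reaches no @[conjecture] decl). -/
@[route_item "route-BirchSwinnertonDyer-ManinLocalTwoThree"]
def ManinConstantOneRung : Prop :=
  ∀ (W : WeierstrassCurve ℚ) [W.IsElliptic] [W.IsGloballyMinimal] {N : ℕ} [NeZero N] (D : Literature.NumberTheory.EllipticCurves.ModularForms.ModularParametrizationData W N), (∀ z ∈ D.L.lattice, ∃ w ∈ Literature.NumberTheory.EllipticCurves.ModularForms.periodLattice D.f, z = D.c * w) → |D.maninConstant| = 1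

-- earlier ManinOddAtFour (stmt-BirchSwinnertonDyer-22446, replaced 2026-08-27T21:38:22Z -> stmt-BirchSwinnertonDyer-22967): retired by None — ∀ (W : WeierstrassCurve ℚ) [W.IsElliptic] [W.IsGloballyMinimal] {N : ℕ} [NeZero N] (D : Literature.NumberTheory.EllipticCurves.ModularForms.ModularParametrizationData W N), (∀ z ∈ D.L.lattice, ∃ w ∈ Literature.NumberTheory.EllipticCurves.ModularForms.periodLat
/-- item stmt-BirchSwinnertonDyer-22967 · crux · rank 2 · open · by planner
why it might fail: a class with 4 ∣ N whose Γ₁-constant is 1 but c₀ = 2 (ČNS Lemma 6.5 allows c₀/c₁ ∈ {1,2}; Stevens' η = 2 exists at 11a) refutes it; twist transport needs η(W′) = 1 and twist-minimal classes (v₂(N) ∈ {5,…,8}) have no semistable partner; the fact hypotheses do not touch additive 2.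
sources: Cesnavicius2018, CesnaviciusNeururerSaha2023, arXiv:1606.03172, AgasheRibetStein2006, Stevens1989, DiamondShurman2005
[crux] EDIT 2 (birth repair): the three printed semistable-prime facts (Mazur 1978 Cor. 4.1,
Abbes–Ullmo 1996 Thm. A, Česnavičius 2018 Thm. 1.2) and the Modularity Theorem `exists_isNewformOf`
(Diamond–Shurman Thm. 8.8.3 = Wiles / Taylor–Wiles / BCDT 2001) as explicit hypotheses (the `(h :
Fact) →` form in which the tree's twist-transport certificates consume them); body unchanged. For
every globally minimal W/ℚ, every level N with 4 ∣ N and every X₀(N)-datum D of W with Λ_W = c·Λ_f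
(optimal parametrisation), the Manin constant c is odd — Manin's conjecture at the prime 2 for
curves additive at 2, GIVEN the printed facts and modularity. [deps: PrintedSemistableManinFacts
(whose fourth conjunct is the Modularity Theorem)] [difficulty: open-problem] -/
@[route_item "route-BirchSwinnertonDyer-ManinLocalTwoThree", crux]
def ManinOddAtFour : Prop :=
  Literature.NumberTheory.EllipticCurves.ModularForms.mazur_not_dvd_maninConstant_of_odd → Literature.NumberTheory.EllipticCurves.ModularForms.abbesUllmo_not_dvd_maninConstant_of_not_dvd_level → Literature.NumberTheory.EllipticCurves.ModularForms.cesnavicius_not_two_dvd_maninConstant_of_two_dvd_level → Literature.NumberTheory.EllipticCurves.ModularForms.exists_isNewformOf → ∀ (W : WeierstrassCurve ℚ) [W.IsElliptic] [W.IsGloballyMinimal] {N : ℕ} [NeZero N] (D : Literature.NumberTheory.EllipticCurves.ModularForms.ModularParametrizationData W N), (∀ z ∈ D.L.lattice, ∃ w ∈ Literature.NumberTheory.EllipticCurves.ModularForms.periodLattice D.f, z = D.c * w) → 2 ^ 2 ∣ N → ¬ (2 : ℤ) ∣ D.maninConstant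

-- earlier ManinPrimeToThreeAtNine (stmt-BirchSwinnertonDyer-22447, replaced 2026-08-27T21:38:22Z -> stmt-BirchSwinnertonDyer-22968): retired by None — ∀ (W : WeierstrassCurve ℚ) [W.IsElliptic] [W.IsGloballyMinimal] {N : ℕ} [NeZero N] (D : Literature.NumberTheory.EllipticCurves.ModularForms.ModularParametrizationData W N), (∀ z ∈ D.L.lattice, ∃ w ∈ Literature.NumberTheory.EllipticCurves.ModularForms.
/-- item stmt-BirchSwinnertonDyer-22968 · crux · rank 3 · open · by planner
why it might fail: twist-minimal classes at 3 (27 ∣ N, or 9 ∥ N not a χ₋₃-twist of a 3-semistable class) have no transport partner; ČNS give only v₃(c) ≤ v₃(deg φ)(+1) and 3 ∣ deg φ is forced on whole families (cell THEOREM T₃); Raynaud's e < p − 1 fails at p = 3; the fact hypotheses do not touch additive 3.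
sources: CesnaviciusNeururerSaha2023, EdixhovenManin1991, arXiv:1705.09251, Stevens1989, DiamondShurman2005
[crux] EDIT 2 (birth repair): the three printed semistable-prime facts (Mazur 1978 Cor. 4.1,
Abbes–Ullmo 1996 Thm. A, Česnavičius 2018 Thm. 1.2) and the Modularity Theorem `exists_isNewformOf`
(Diamond–Shurman Thm. 8.8.3 = Wiles / Taylor–Wiles / BCDT 2001) as explicit hypotheses (the `(h :
Fact) →` form in which the tree's twist-transport certificates consume them); body unchanged. For
every globally minimal W/ℚ, every level N with 9 ∣ N and every optimal X₀(N)-datum D of W (lattice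
clause), 3 ∤ c — Manin's conjecture at the prime 3 for curves additive at 3, GIVEN the printed facts
and modularity. [deps: PrintedSemistableManinFacts (whose fourth conjunct is the Modularity
Theorem)] [difficulty: open-problem] -/
@[route_item "route-BirchSwinnertonDyer-ManinLocalTwoThree", crux]
def ManinPrimeToThreeAtNine : Prop :=
  Literature.NumberTheory.EllipticCurves.ModularForms.mazur_not_dvd_maninConstant_of_odd → Literature.NumberTheory.EllipticCurves.ModularForms.abbesUllmo_not_dvd_maninConstant_of_not_dvd_level → Literature.NumberTheory.EllipticCurves.ModularForms.cesnavicius_not_two_dvd_maninConstant_of_two_dvd_level → Literature.NumberTheory.EllipticCurves.ModularForms.exists_isNewformOf → ∀ (W : WeierstrassCurve ℚ) [W.IsElliptic] [W.IsGloballyMinimal] {N : ℕ} [NeZero N] (D : Literature.NumberTheory.EllipticCurves.ModularForms.ModularParametrizationData W N), (∀ z ∈ D.L.lattice, ∃ w ∈ Literature.NumberTheory.EllipticCurves.ModularForms.periodLattice D.f, z = D.c * w) → 3 ^ 2 ∣ N → ¬ (3 : ℤ) ∣ D.maninConstant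

-- earlier ManinPrimeToAdditiveFiveLe (stmt-BirchSwinnertonDyer-22448, replaced 2026-08-27T21:38:22Z -> stmt-BirchSwinnertonDyer-22969): retired by None — ∀ (W : WeierstrassCurve ℚ) [W.IsElliptic] [W.IsGloballyMinimal] {N : ℕ} [NeZero N] (D : Literature.NumberTheory.EllipticCurves.ModularForms.ModularParametrizationData W N), (∀ z ∈ D.L.lattice, ∃ w ∈ Literature.NumberTheory.EllipticCurves.ModularFor
/-- item stmt-BirchSwinnertonDyer-22969 · crux · rank 4 · open · by planner
why it might fail: at p = 5, 7 Raynaud's constraint e < p − 1 on finite flat group schemes fails for e = 6 (Edixhoven's method is void), and Pasten's Thm. 10.1 bounds v_p(c) without reaching 0; a single optimal curve with 25 ∣ N, 5 ∣ c beyond N = 500000 kills it.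
sources: EdixhovenManin1991, arXiv:1705.09251, CesnaviciusNeururerSaha2023, DiamondShurman2005
[crux] EDIT 2 (birth repair) + residual-boundary amendment (Q-ref2-7): the three printed
semistable-prime facts (Mazur 1978 Cor. 4.1, Abbes–Ullmo 1996 Thm. A, Česnavičius 2018 Thm. 1.2) and
the Modularity Theorem `exists_isNewformOf` (Diamond–Shurman Thm. 8.8.3 = Wiles / Taylor–Wiles /
BCDT 2001) as explicit hypotheses (the `(h : Fact) →` form in which the tree's twist-transport
certificates consume them); body unchanged. RESIDUAL conjunct (declared residual, not attacked by
this cell): for every globally minimal W/ℚ, every N and every optimal X₀(N)-datum D of W, every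
prime p ≥ 5 with p² ∣ N satisfies p ∤ c, GIVEN the printed facts and modularity (open at p = 5, 7
and at p ≥ 11 of potentially ordinary Kodaira type II/III/IV; the rest is Edixhoven 1991 Thm. 3 —
which itself uses modularity — FOR W[p] IRREDUCIBLE (the printed §4 chain, repaired on flip rows by
the cell's E-an-31) or p ∉ {11, 17}; for W[p] REDUCIBLE at additive p ∈ {11, 17} (j ∈ {−11²,
−11·131³, −17²·101³/2, −17·373³/2¹⁷} and their prime-to-p quadratic twists) the printed chain is
contradicted by the flip pair 121c1/121a1 and p ∤ c rests on Edixhoven's unpublished thesis Thm.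
4.6.3 (acq-13486) — not safely in print — -/
@[route_item "route-BirchSwinnertonDyer-ManinLocalTwoThree", crux]
def ManinPrimeToAdditiveFiveLe : Prop :=
  Literature.NumberTheory.EllipticCurves.ModularForms.mazur_not_dvd_maninConstant_of_odd → Literature.NumberTheory.EllipticCurves.ModularForms.abbesUllmo_not_dvd_maninConstant_of_not_dvd_level → Literature.NumberTheory.EllipticCurves.ModularForms.cesnavicius_not_two_dvd_maninConstant_of_two_dvd_level → Literature.NumberTheory.EllipticCurves.ModularForms.exists_isNewformOf → ∀ (W : WeierstrassCurve ℚ) [W.IsElliptic] [W.IsGloballyMinimal] {N : ℕ} [NeZero N] (D : Literature.NumberTheory.EllipticCurves.ModularForms.ModularParametrizationData W N), (∀ z ∈ D.L.lattice, ∃ w ∈ Literature.NumberTheory.EllipticCurves.ModularForms.periodLattice D.f, z = D.c * w) → ∀ p : ℕ, p.Prime → 5 ≤ p → p ^ 2 ∣ N → ¬ (p : ℤ) ∣ D.maninConstant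

-- earlier PrintedSemistableManinFacts (stmt-BirchSwinnertonDyer-22449, replaced 2026-08-27T21:38:22Z -> stmt-BirchSwinnertonDyer-22970): retired by None — Literature.NumberTheory.EllipticCurves.ModularForms.mazur_not_dvd_maninConstant_of_odd ∧ Literature.NumberTheory.EllipticCurves.ModularForms.abbesUllmo_not_dvd_maninConstant_of_not_dvd_level ∧ Literature.NumberTheory.EllipticCurves.ModularForms.ce
/-- item stmt-BirchSwinnertonDyer-22970 · support · rank 9 · SPLIT (gen 1) into MazurManinConstantOddPrimes, AbbesUllmoManinConstantGoodPrimes, CesnaviciusManinConstantAtTwo, NewformOfEllipticCurve + glue PrintedSemistableManinFactsOfParts · direct attempts still welcome (low priority) · by planner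
sources: Mazur1978, AbbesUllmo1996, Cesnavicius2018, DiamondShurman2005
[support] EDIT 2 (birth repair): the printed facts the cruxes are conditioned on, by name, as ONE
conjunction: Mazur 1978 Cor. 4.1 (odd p, p² ∤ N ⇒ p ∤ c), Abbes–Ullmo 1996 Thm. A (p ∤ N ⇒ p ∤ c),
Česnavičius 2018 Thm. 1.2 (2 ∥ N ⇒ 2 ∤ c) in the tree's lattice rendering, AND (fourth conjunct,
new) the Modularity Theorem `exists_isNewformOf` (Diamond–Shurman Thm. 8.8.3 = Wiles 1995 /
Taylor–Wiles / BCDT 2001; a named Literature fact without `_holds`, consumed as the hypothesis `hnf`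
by every tree twist-transport certificate). Literature facts consumed as hypotheses (precedent:
AdditiveKolyvaginRoad.MazurManinConstantOddPrimes). Folding modularity in here keeps the `Assembly`
statement and the deciding theorem `closes` byte-identical to the birth file. [difficulty: routine —
it is a hypothesis bundle, never a proof target] -/
@[route_item "route-BirchSwinnertonDyer-ManinLocalTwoThree", crux]
def PrintedSemistableManinFacts : Prop :=
  Literature.NumberTheory.EllipticCurves.ModularForms.mazur_not_dvd_maninConstant_of_odd ∧ Literature.NumberTheory.EllipticCurves.ModularForms.abbesUllmo_not_dvd_maninConstant_of_not_dvd_level ∧ Literature.NumberTheory.EllipticCurves.ModularForms.cesnavicius_not_two_dvd_maninConstant_of_two_dvd_level ∧ Literature.NumberTheory.EllipticCurves.ModularForms.exists_isNewformOf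

-- parent: PrintedSemistableManinFacts · child (gen 1)
/--     item stmt-BirchSwinnertonDyer-19383 · support · rank 901 · open
    parent: PrintedSemistableManinFacts · by planner
    sources: Mazur1978, EdixhovenManin1991
[support] Mazur 1978 Cor. 4.1 (with Edixhoven 1991 Prop. 2: c ∈ ℤ): for every odd prime p with p² ∤
N the Manin constant is prime to p — conjunct of PublishedInputsFive
(stmt-BirchSwinnertonDyer-19066), BY NAME; same content, filed as a split child so the head constant
is item-stated (gate5 #15c one rule / readiness rule 2026-08-15: a cite_only dep must be declared by
the route); no crux statement / closes / tribunal / tribunal_fit change -/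
@[route_item "route-BirchSwinnertonDyer-ManinLocalTwoThree"]
def MazurManinConstantOddPrimes : Prop :=
  Literature.NumberTheory.EllipticCurves.ModularForms.mazur_not_dvd_maninConstant_of_odd

-- parent: PrintedSemistableManinFacts · child (gen 1)
/--     item stmt-BirchSwinnertonDyer-20090 · support · rank 902 · open
    parent: PrintedSemistableManinFacts · by planner
    sources: AbbesUllmo1996
[support] BY NAME, cite_only input: Abbes–Ullmo 1996 Thm A — for the lattice-optimal datum and p ∤
N, p ∤ c (`abbesUllmo_not_dvd_maninConstant_of_not_dvd_level`); consumed by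
`not_dvd_maninConstant_of_kodairaSymbolAt_eq_Istar`. [difficulty: hypothesis-only] -/
@[route_item "route-BirchSwinnertonDyer-ManinLocalTwoThree"]
def AbbesUllmoManinConstantGoodPrimes : Prop :=
  Literature.NumberTheory.EllipticCurves.ModularForms.abbesUllmo_not_dvd_maninConstant_of_not_dvd_level

-- parent: PrintedSemistableManinFacts · child (gen 1)
/--     item stmt-BirchSwinnertonDyer-20091 · support · rank 903 · open
    parent: PrintedSemistableManinFacts · by planner
    sources: Cesnavicius2018
[support] BY NAME, cite_only input: Česnavičius 2018 Thm 1.2 (2 ∥ N ⇒ 2 ∤ c for the lattice-optimal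
datum; `cesnavicius_not_two_dvd_maninConstant_of_two_dvd_level`) — a hypothesis of the tree theorem
`not_dvd_maninConstant_of_kodairaSymbolAt_eq_Istar` as typed (its semistable-twist step is
prime-uniform); not used at the odd p of this route otherwise. [difficulty: hypothesis-only] -/
@[route_item "route-BirchSwinnertonDyer-ManinLocalTwoThree"]
def CesnaviciusManinConstantAtTwo : Prop :=
  Literature.NumberTheory.EllipticCurves.ModularForms.cesnavicius_not_two_dvd_maninConstant_of_two_dvd_level

-- parent: PrintedSemistableManinFacts · child (gen 1)
/--     item stmt-BirchSwinnertonDyer-19382 · support · rank 904 · open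
    parent: PrintedSemistableManinFacts · by planner
    sources: BCDTJAMS2001, DiamondShurman2005
[support] Modularity Theorem, Version L (Diamond–Shurman 2005 Thm. 8.8.3; Wiles / Taylor–Wiles /
BCDT 2001 Thm. A): every E/ℚ has a weight-2 newform f of level N_E with L(f,s) = L(E,s) — conjunct
of PublishedInputsFive (stmt-BirchSwinnertonDyer-19066), BY NAME; same content, filed as a split
child so the head constant is item-stated (gate5 #15c one rule / readiness rule 2026-08-15: a
cite_only dep must be declared by the route); no crux statement / closes / tribunal / tribunal_fit
change -/
@[route_item "route-BirchSwinnertonDyer-ManinLocalTwoThree"]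
def NewformOfEllipticCurve : Prop :=
  Literature.NumberTheory.EllipticCurves.ModularForms.exists_isNewformOf

-- parent: PrintedSemistableManinFacts · glue (gen 1)
/--     item stmt-BirchSwinnertonDyer-23061 · support · rank 905 · closed · proved by Summit.BirchSwinnertonDyer.BirchSwinnertonDyer.Theorems.maninLocalTwoThree_printedSemistableManinFactsOfParts_proof (prover)
    parent: PrintedSemistableManinFacts · GLUE: children ⟹ parent · by planner
pure logic: PrintedSemistableManinFacts (stmt-BirchSwinnertonDyer-22970) is the conjunction of the
four item-stated held printed facts — MazurManinConstantOddPrimes →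
AbbesUllmoManinConstantGoodPrimes → CesnaviciusManinConstantAtTwo → NewformOfEllipticCurve →
PrintedSemistableManinFacts; proof term `fun hM hAU hC hnf => And.intro hM (And.intro hAU (And.intro
hC hnf))` (kernel-checked as `printedSemistableManinFactsOfParts_holds` in the planner's
Sketch4.lean, HOME/imc/lines/Sketch4.lean, farm rc 0 / 0 sorries); provable now — any prover lands
it (e.g. together with the Assembly proof `assembly_holds`,
HOME/typer/ManinLocalTwoThreeAssembly.lean) as `theorem … : PrintedSemistableManinFactsOfParts`
under Theorems/ with `--workitem stmt-BirchSwinnertonDyer-23061`. -/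
@[route_item "route-BirchSwinnertonDyer-ManinLocalTwoThree"]
def PrintedSemistableManinFactsOfParts : Prop :=
  MazurManinConstantOddPrimes → AbbesUllmoManinConstantGoodPrimes → CesnaviciusManinConstantAtTwo → NewformOfEllipticCurve → PrintedSemistableManinFacts

-- `PrintedSemistableManinFactsOfParts` holds: proved by `Summit.BirchSwinnertonDyer.BirchSwinnertonDyer.Theorems.maninLocalTwoThree_printedSemistableManinFactsOfParts_proof` (its module imports this route file, so no `_holds` link can be stated here).

/-- item stmt-BirchSwinnertonDyer-22450 · assembly · rank 1 · closed · proved by Summit.BirchSwinnertonDyer.BirchSwinnertonDyer.Theorems.maninLocalTwoThree_assembly_proof (prover) · by planner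
sources: Cesnavicius2018, CesnaviciusNeururerSaha2023
[assembly] PrintedSemistableManinFacts → ManinOddAtFour → ManinPrimeToThreeAtNine →
ManinPrimeToAdditiveFiveLe → ManinConstantOneRung (Manin's conjecture); provable now (pure logic,
proof in folder/Sketch.lean `assembly_holds`). -/
@[route_item "route-BirchSwinnertonDyer-ManinLocalTwoThree", crux]
def Assembly : Prop :=
  PrintedSemistableManinFacts → ManinOddAtFour → ManinPrimeToThreeAtNine → ManinPrimeToAdditiveFiveLe → ManinConstantOneRung

-- `Assembly` holds: proved by `Summit.BirchSwinnertonDyer.BirchSwinnertonDyer.Theorems.maninLocalTwoThree_assembly_proof` (its module imports this route file, so no `_holds` link can be stated here).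

/-! D-0027 §2.1 — DECIDING THEOREM (planner-authored via `route open/edit --closes-file`; by planner-bsd-f2-manin-imc-g7-0 2026-08-27T20:50:32Z):
its hypotheses are this route's items and its conclusion the registered leaf `Summit.BirchSwinnertonDyer.Rank1Residual.ManinConstant.ManinConstantOne` (rung F2-MANIN, D-0061) (glue_lint), and it elaborates with this file. -/

-- glue.lean — DECIDING THEOREM of route ManinLocalTwoThree (D-0027 §2.1; D-0061 rung shape, alternative closer
-- «F2-MANIN» = the registered leaf `Summit.BirchSwinnertonDyer.Rank1Residual.ManinConstant.ManinConstantOne`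
-- (Manin's conjecture), concluded BY NAME. Hypotheses = support PrintedSemistableManinFacts + cruxes ManinOddAtFour
-- (r2, deciding), ManinPrimeToThreeAtNine (r3), ManinPrimeToAdditiveFiveLe (r4, RESIDUAL conjunct) + the Assembly
-- item (PROVABLE NOW: `assembly_holds` kernel-checked in folder/Sketch.lean, farm rc 0, 0 sorries; its conclusion,
-- the target item `ManinConstantOneRung`, is the leaf verbatim, `Iff.rfl`). Every binder is consumed.
-- No summit is proved by this line; nothing here bears on the truth of BSD.
@[closes "route-BirchSwinnertonDyer-ManinLocalTwoThree"] theorem closes (hPF : PrintedSemistableManinFacts) (h2 : ManinOddAtFour)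
    (h3 : ManinPrimeToThreeAtNine) (h5 : ManinPrimeToAdditiveFiveLe) (hA : Assembly) :
    Summit.BirchSwinnertonDyer.Rank1Residual.ManinConstant.ManinConstantOne :=
  hA hPF h2 h3 h5

end Summit.BirchSwinnertonDyer.BirchSwinnertonDyer.Theses.ManinLocalTwoThree
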